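import Summits.QuantumFields.YangMills.Theorems.VirialFluxGapSharpTwistedLaplaceQuantitativeLaplaceMethod
import Literature.Analysis.Asymptotics.LaplaceMethodChart
import HarnessLib

/-!
# Laplace's method with an explicit `O(1/β)` remainder THROUGH A CHART WITH DENSITY
# (the quantitative twin of `Literature.Analysis.Asymptotics.tendsto_laplaceMethod_chart`)

Helper module (free-hands work of width seat ym-line-sfw-p2-w2 g49, cell ym-idea-1) toward crux
⟨stmt-QuantumFields-24204⟩ `VirialFluxGap.SharpTwistedLaplace`; PART 6 of the quantitative Laplace stack (the
one-chart case: an isolated non-degenerate minimum read in a chart `Θ : V → X` with `dμ = J dy` on the patch —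
e.g. Haar measure in exponential coordinates after a complete gauge fixing; the ORBIT case is part 4
`…QuantitativeLaplaceOrbit`).  Everything here is PROVED; no definitions, no named facts (namespace
`Summit.QuantumFields.YangMills.Theorems.QuantitativeLaplace`).

THE STATEMENTS.  `(X, μ)` a finite measure space, `Θ : V → X` measurable with `Θ(B̄_R)` measurable, `J ≥ 0`
measurable with the CHART IDENTITY `μ|_{Θ(B̄_R)} = Θ_*((J·dy)|_{B̄_R})` (the `hchart` of `tendsto_laplaceMethod_chart`),
measurable `f, φ`, and the window data of the Euclidean core for `y ↦ f(Θ y) − f₀` and `y ↦ J(y)·φ(Θ y)`: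
★★ `laplaceMethod_quantitative_chart_patch` — `|∫_{Θ(B̄_R)} e^{−β(f−f₀)}φ dμ − w₀𝔊(β)| ≤ (K/β)·w₀𝔊(β)`;
★★ `laplaceMethod_quantitative_chart` — with `f ≥ f₀ + η₀` off the patch and `|φ| ≤ Φ₀`:
`|∫_X e^{−β(f−f₀)}φ dμ − w₀𝔊(β)| ≤ (K/β)·w₀𝔊(β) + Φ₀·μ(X)·e^{−βη₀}`; `K` the explicit polynomial of the core.

HONEST FRAMING: classical analysis ∕ measure theory; width 0 by itself toward any lattice statement; ⟨24204⟩,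
⟨24319⟩ and every rung stay OPEN; the Yang–Mills mass gap (Clay) is NOT touched; no summit is proved by a line.

## References
* K. W. Breitung, *Asymptotic Approximations for Probability Integrals*, LNM 1592 (1994), §2.3 Definitions 4–5 pp. 14–15, Thm 41 p. 56. [Breitung1994]
* S. Helgason, *Groups and Geometric Analysis* (2000), Ch. I §1 Thm 1.14 (13) p. 96. [Helgason2000]
-/

noncomputable section

open _root_.MeasureTheory _root_.MeasureTheory.Measure _root_.Filter _root_.Set _root_.Module _root_.Metric
open scoped _root_.Topology _root_.Real _root_.InnerProductSpace _root_.ENNReal _root_.NNReal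

namespace Summit.QuantumFields.YangMills.Theorems.QuantitativeLaplace

open Literature.Analysis.Asymptotics

variable {V : Type*} [NormedAddCommGroup V] [InnerProductSpace ℝ V] [FiniteDimensional ℝ V]
  [MeasurableSpace V] [BorelSpace V]
variable {X : Type*} [MeasurableSpace X] {μ : Measure X} [IsFiniteMeasure μ]

omit [IsFiniteMeasure μ] in
/-- ★★ **The PATCH part, quantitatively**: under the chart identity `μ|_{Θ(B̄_R)} = Θ_*((J·dy)|_{B̄_R})` and the
window data of the Euclidean core for `f∘Θ − f₀` and `J·φ∘Θ`, the weight `e^{−β(f−f₀)}φ` is integrable on the patch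
and `|∫_{Θ(B̄_R)} e^{−β(f−f₀)}φ dμ − w₀𝔊(β)| ≤ (K/β)·w₀𝔊(β)`.
[cite: Breitung1994, Thm 41 p. 56 with §2.3 Definitions 4–5 pp. 14–15] -/
theorem laplaceMethod_quantitative_chart_patch {Θ : V → X} (hΘm : Measurable Θ) {R : ℝ} (hR : 0 < R)
    {J : V → ℝ} (hJm : Measurable J) (hJ0 : ∀ y ∈ closedBall (0 : V) R, 0 ≤ J y)
    (hchart : μ.restrict (Θ '' closedBall (0 : V) R) =
      (((volume : Measure V).restrict (closedBall (0 : V) R)).withDensity fun y => ENNReal.ofReal (J y)).map Θ)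
    {f φ : X → ℝ} (hfm : Measurable f) (hφm : Measurable φ) {f₀ : ℝ}
    {A : V →ₗ[ℝ] V} {lam : ℝ} (hAs : A.IsSymmetric) (hlam : 0 < lam)
    (hcoer : ∀ y : V, lam * ‖y‖ ^ 2 ≤ ⟪A y, y⟫_ℝ)
    {A₃ A₄ D G β w₀ : ℝ} (hA₃ : 0 ≤ A₃) (hA₄ : 0 ≤ A₄) (hD : 0 ≤ D) (hG : 0 ≤ G)
    (hβ : 0 < β) (hw₀ : 0 ≤ w₀)
    (hsmall : A₃ * R + A₄ * R ^ 2 ≤ lam / (8 * ((finrank ℝ V : ℝ) + 8)))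
    (hDR : D * R ≤ 1) (hGR : G * R ^ 2 ≤ 1)
    {cc rr ll ee : V → ℝ} (hc_meas : Measurable cc) (hr_meas : Measurable rr) (hℓ_meas : Measurable ll)
    (he_meas : Measurable ee) (hc_odd : ∀ y, cc (-y) = -cc y) (hℓ_odd : ∀ y, ll (-y) = -ll y)
    (hc : ∀ y : V, ‖y‖ ≤ R → |cc y| ≤ A₃ * ‖y‖ ^ 3) (hr : ∀ y : V, ‖y‖ ≤ R → |rr y| ≤ A₄ * ‖y‖ ^ 4)
    (hℓ : ∀ y : V, ‖y‖ ≤ R → |ll y| ≤ D * ‖y‖) (he : ∀ y : V, ‖y‖ ≤ R → |ee y| ≤ G * ‖y‖ ^ 2)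
    (hf : ∀ y : V, ‖y‖ ≤ R → f (Θ y) - f₀ = (1 / 2) * ⟪A y, y⟫_ℝ + cc y + rr y)
    (hw : ∀ y : V, ‖y‖ ≤ R → J y * φ (Θ y) = w₀ * (1 + ll y + ee y)) :
    IntegrableOn (fun x => Real.exp (-(β * (f x - f₀))) * φ x) (Θ '' closedBall (0 : V) R) μ ∧
    |(∫ x in Θ '' closedBall (0 : V) R, Real.exp (-(β * (f x - f₀))) * φ x ∂μ) - w₀ * ((2 * π / β) ^ ((finrank ℝ V : ℝ) / 2) / Real.sqrt (LinearMap.det A))| ≤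
      (16 * ((finrank ℝ V : ℝ) + 8) / (lam * R ^ 2) + 16 * G * ((finrank ℝ V : ℝ) + 8) / lam
        + 256 * (A₄ + (A₃ + A₄ * R) * (D + G * R)) * ((finrank ℝ V : ℝ) + 8) ^ 2 / lam ^ 2
        + 18432 * (A₃ + A₄ * R) ^ 2 * ((finrank ℝ V : ℝ) + 8) ^ 3 / lam ^ 3) / β * (w₀ * ((2 * π / β) ^ ((finrank ℝ V : ℝ) / 2) / Real.sqrt (LinearMap.det A))) := by
  set B : Set V := closedBall (0 : V) R with hBdef
  have hB : MeasurableSet B := measurableSet_closedBall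
  set F : X → ℝ := fun x => Real.exp (-(β * (f x - f₀))) * φ x with hFdef
  have hFm : Measurable F := (((hfm.sub measurable_const).const_mul β).neg.exp).mul hφm
  set g : V → ℝ := fun y => Real.exp (-(β * (f (Θ y) - f₀))) * (J y * φ (Θ y)) with hgdef
  have hJF : ∀ y : V, J y * F (Θ y) = g y := fun y => by simp only [hFdef, hgdef]; ring
  have hgbd : ∀ y ∈ B, |g y| ≤ 3 * w₀ := by
    intro y hy
    have hyR : ‖y‖ ≤ R := by simpa [hBdef] using hy
    have h3 := laplace_abs_integrand_le_three hlam hcoer hA₃ hA₄ hD hG hβ hsmall hDR hGR hc hr hℓ he y hyR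
    have hgy : g y = w₀ * (Real.exp (-(β * (((1 / 2) * ⟪A y, y⟫_ℝ) + cc y + rr y))) * (1 + ll y + ee y)) := by
      simp only [hgdef]; rw [hf y hyR, hw y hyR]; ring
    rw [hgy, abs_mul, abs_of_nonneg hw₀]
    calc w₀ * |Real.exp (-(β * (((1 / 2) * ⟪A y, y⟫_ℝ) + cc y + rr y))) * (1 + ll y + ee y)| ≤ w₀ * 3 :=
        mul_le_mul_of_nonneg_left h3 hw₀
      _ = 3 * w₀ := by ring
  have hgint : IntegrableOn (fun y => J y * F (Θ y)) B volume :=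
    Measure.integrableOn_of_bounded (M := 3 * w₀) (by rw [hBdef]; exact measure_closedBall_lt_top.ne)
      (hJm.mul (hFm.comp hΘm)).aestronglyMeasurable
      ((ae_restrict_iff' hB).mpr (Eventually.of_forall fun y hy => by
        rw [Real.norm_eq_abs, hJF y]; exact hgbd y hy))
  have hTint : IntegrableOn F (Θ '' B) μ :=
    (integrableOn_image_iff_of_chart hΘm hB hJm hJ0 hchart hFm).mpr hgint
  have hpatch : ∫ x in Θ '' B, F x ∂μ = ∫ y in B, g y := by
    rw [setIntegral_image_eq_of_chart hΘm hB hJm hJ0 hchart hFm]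
    exact setIntegral_congr_fun hB fun y _ => hJF y
  have hcore : |(∫ y in B, g y) - w₀ * ((2 * π / β) ^ ((finrank ℝ V : ℝ) / 2) / Real.sqrt (LinearMap.det A))| ≤ (16 * ((finrank ℝ V : ℝ) + 8) / (lam * R ^ 2) + 16 * G * ((finrank ℝ V : ℝ) + 8) / lam
        + 256 * (A₄ + (A₃ + A₄ * R) * (D + G * R)) * ((finrank ℝ V : ℝ) + 8) ^ 2 / lam ^ 2
        + 18432 * (A₃ + A₄ * R) ^ 2 * ((finrank ℝ V : ℝ) + 8) ^ 3 / lam ^ 3) / β * (w₀ * ((2 * π / β) ^ ((finrank ℝ V : ℝ) / 2) / Real.sqrt (LinearMap.det A))) := by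
    rw [hBdef]
    exact laplaceMethod_quantitative_of_eqOn (f := fun y => f (Θ y) - f₀) (w := fun y => J y * φ (Θ y))
      hAs hlam hcoer hR hA₃ hA₄ hD hG hβ hw₀ hsmall hDR hGR hc_meas hr_meas hℓ_meas he_meas hc_odd hℓ_odd
      hc hr hℓ he hf hw
  exact ⟨hTint, by rw [hpatch]; exact hcore⟩

/-- ★★ **Laplace's method through a chart with density, with an explicit `O(1/β)` remainder** — the quantitative
twin of `tendsto_laplaceMethod_chart`: the patch part plus the separated complement (`f ≥ f₀ + η₀` off the patch,
`|φ| ≤ Φ₀`). [cite: Breitung1994, Thm 41 p. 56 with §2.3 Definitions 4–5 pp. 14–15]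
[cite: Helgason2000, Ch. I §1 Thm 1.14 (13) p. 96] -/
theorem laplaceMethod_quantitative_chart {Θ : V → X} (hΘm : Measurable Θ) {R : ℝ} (hR : 0 < R)
    (hΘΩ : MeasurableSet (Θ '' closedBall (0 : V) R))
    {J : V → ℝ} (hJm : Measurable J) (hJ0 : ∀ y ∈ closedBall (0 : V) R, 0 ≤ J y)
    (hchart : μ.restrict (Θ '' closedBall (0 : V) R) =
      (((volume : Measure V).restrict (closedBall (0 : V) R)).withDensity fun y => ENNReal.ofReal (J y)).map Θ)
    {f φ : X → ℝ} (hfm : Measurable f) (hφm : Measurable φ) {f₀ : ℝ}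
    {A : V →ₗ[ℝ] V} {lam : ℝ} (hAs : A.IsSymmetric) (hlam : 0 < lam)
    (hcoer : ∀ y : V, lam * ‖y‖ ^ 2 ≤ ⟪A y, y⟫_ℝ)
    {A₃ A₄ D G β w₀ : ℝ} (hA₃ : 0 ≤ A₃) (hA₄ : 0 ≤ A₄) (hD : 0 ≤ D) (hG : 0 ≤ G)
    (hβ : 0 < β) (hw₀ : 0 ≤ w₀)
    (hsmall : A₃ * R + A₄ * R ^ 2 ≤ lam / (8 * ((finrank ℝ V : ℝ) + 8)))
    (hDR : D * R ≤ 1) (hGR : G * R ^ 2 ≤ 1)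
    {cc rr ll ee : V → ℝ} (hc_meas : Measurable cc) (hr_meas : Measurable rr) (hℓ_meas : Measurable ll)
    (he_meas : Measurable ee) (hc_odd : ∀ y, cc (-y) = -cc y) (hℓ_odd : ∀ y, ll (-y) = -ll y)
    (hc : ∀ y : V, ‖y‖ ≤ R → |cc y| ≤ A₃ * ‖y‖ ^ 3) (hr : ∀ y : V, ‖y‖ ≤ R → |rr y| ≤ A₄ * ‖y‖ ^ 4)
    (hℓ : ∀ y : V, ‖y‖ ≤ R → |ll y| ≤ D * ‖y‖) (he : ∀ y : V, ‖y‖ ≤ R → |ee y| ≤ G * ‖y‖ ^ 2)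
    (hf : ∀ y : V, ‖y‖ ≤ R → f (Θ y) - f₀ = (1 / 2) * ⟪A y, y⟫_ℝ + cc y + rr y)
    (hw : ∀ y : V, ‖y‖ ≤ R → J y * φ (Θ y) = w₀ * (1 + ll y + ee y))
    {η₀ Φ₀ : ℝ} (hout : ∀ x, x ∉ Θ '' closedBall (0 : V) R → f₀ + η₀ ≤ f x) (hφb : ∀ x, |φ x| ≤ Φ₀) :
    |(∫ x, Real.exp (-(β * (f x - f₀))) * φ x ∂μ) - w₀ * ((2 * π / β) ^ ((finrank ℝ V : ℝ) / 2) / Real.sqrt (LinearMap.det A))| ≤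
      (16 * ((finrank ℝ V : ℝ) + 8) / (lam * R ^ 2) + 16 * G * ((finrank ℝ V : ℝ) + 8) / lam
        + 256 * (A₄ + (A₃ + A₄ * R) * (D + G * R)) * ((finrank ℝ V : ℝ) + 8) ^ 2 / lam ^ 2
        + 18432 * (A₃ + A₄ * R) ^ 2 * ((finrank ℝ V : ℝ) + 8) ^ 3 / lam ^ 3) / β * (w₀ * ((2 * π / β) ^ ((finrank ℝ V : ℝ) / 2) / Real.sqrt (LinearMap.det A))) + Φ₀ * μ.real univ * Real.exp (-(β * η₀)) := by
  obtain ⟨hTint, hpatch⟩ := laplaceMethod_quantitative_chart_patch hΘm hR hJm hJ0 hchart hfm hφm hAs hlam hcoer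
    hA₃ hA₄ hD hG hβ hw₀ hsmall hDR hGR hc_meas hr_meas hℓ_meas he_meas hc_odd hℓ_odd hc hr hℓ he hf hw
  set T : Set X := Θ '' closedBall (0 : V) R with hTdef
  set F : X → ℝ := fun x => Real.exp (-(β * (f x - f₀))) * φ x with hFdef
  have hΦ₀ : 0 ≤ Φ₀ := (abs_nonneg _).trans (hφb (Θ 0))
  have hFm : Measurable F := (((hfm.sub measurable_const).const_mul β).neg.exp).mul hφm
  have hFout : ∀ x, x ∉ T → |F x| ≤ Φ₀ * Real.exp (-(β * η₀)) := by
    intro x hx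
    have h1 : Real.exp (-(β * (f x - f₀))) ≤ Real.exp (-(β * η₀)) := by
      rw [Real.exp_le_exp]; have := hout x hx; nlinarith
    simp only [hFdef]
    rw [abs_mul, abs_of_pos (Real.exp_pos _), mul_comm]
    exact mul_le_mul (hφb x) h1 (Real.exp_pos _).le hΦ₀
  have hTcint : IntegrableOn F Tᶜ μ :=
    Measure.integrableOn_of_bounded (measure_ne_top μ _) hFm.aestronglyMeasurable
      ((ae_restrict_iff' hΘΩ.compl).mpr (Eventually.of_forall fun x hx => by
        rw [Real.norm_eq_abs]; exact hFout x hx))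
  have hFint : Integrable F μ := by
    have h := hTint.union hTcint
    rwa [union_compl_self, integrableOn_univ] at h
  have htail : |∫ x in Tᶜ, F x ∂μ| ≤ Φ₀ * μ.real univ * Real.exp (-(β * η₀)) := by
    have h1 : ‖∫ x in Tᶜ, F x ∂μ‖ ≤ (Φ₀ * Real.exp (-(β * η₀))) * μ.real Tᶜ :=
      norm_setIntegral_le_of_norm_le_const (measure_lt_top μ _) fun x hx => by
        rw [Real.norm_eq_abs]; exact hFout x hx
    rw [Real.norm_eq_abs] at h1
    have h2 : μ.real Tᶜ ≤ μ.real univ := measureReal_mono (subset_univ _)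
    calc |∫ x in Tᶜ, F x ∂μ| ≤ (Φ₀ * Real.exp (-(β * η₀))) * μ.real Tᶜ := h1
      _ ≤ (Φ₀ * Real.exp (-(β * η₀))) * μ.real univ := by gcongr
      _ = Φ₀ * μ.real univ * Real.exp (-(β * η₀)) := by ring
  have hsplit : ∫ x, F x ∂μ = (∫ x in T, F x ∂μ) + ∫ x in Tᶜ, F x ∂μ := (integral_add_compl hΘΩ hFint).symm
  rw [hsplit]
  calc |(∫ x in T, F x ∂μ) + (∫ x in Tᶜ, F x ∂μ) - w₀ * ((2 * π / β) ^ ((finrank ℝ V : ℝ) / 2) / Real.sqrt (LinearMap.det A))|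
      = |((∫ x in T, F x ∂μ) - w₀ * ((2 * π / β) ^ ((finrank ℝ V : ℝ) / 2) / Real.sqrt (LinearMap.det A))) + ∫ x in Tᶜ, F x ∂μ| := by ring_nf
    _ ≤ |(∫ x in T, F x ∂μ) - w₀ * ((2 * π / β) ^ ((finrank ℝ V : ℝ) / 2) / Real.sqrt (LinearMap.det A))| + |∫ x in Tᶜ, F x ∂μ| := abs_add_le _ _
    _ ≤ _ := add_le_add hpatch htail

end Summit.QuantumFields.YangMills.Theorems.QuantitativeLaplace
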